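import Mathlib
import Literature.NumberTheory.Automorphic.HyperbolicLaplaceSpectrum

/-!
# `RationalPeriodQuarter` — linearity of the inlined Lewis–Zagier cocycle in the form (child A, lemma L1)

Support for `RationalPeriodQuarter.HeckeFieldOfCruxes` (stmt-Langlands-10432) via the seed node
`HeckeFieldOfCruxesSplit`, child A `RationalFormsInjectivity`.  The route's inlined
`lzCocycle u γ t = ∫₀¹ (∂U·K dw + U·∂K d w̄)` along the segment from `γ⁻¹ • I` to `I` is `ℂ`-linear in `u`
on `C²` functions (`Literature.NumberTheory.Automorphic.IsC2`): `rpqLZ` below is the route's `lzCocycle`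
VERBATIM (so `rpqLZ u γ t` is definitionally the route's term), and we prove `rpqLZ_add`, `rpqLZ_smul`,
`rpqLZ_zero`, `rpqLZ_linComb` together with the closure lemmas `isC2_add'`, `isC2_smul'`, `isC2_linComb`.
Mathlib + the `IsC2` definition only.
-/

set_option linter.dupNamespace false

namespace Summit.Langlands.Langlands.Theorems

open scoped BigOperators Topology Matrix MatrixGroups
open Filter Set Literature.NumberTheory.Automorphic

/-- The integrand of the route's inlined `lzCocycle` (verbatim), as a function of the parameter `τ`. -/
noncomputable def rpqLZi (u : UpperHalfPlane → ℂ) (γ : Matrix.SpecialLinearGroup (Fin 2) ℤ) (t τ : ℝ) : ℂ :=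
  let w : ℂ := (1 - (τ : ℂ)) * ((γ⁻¹ • UpperHalfPlane.I : UpperHalfPlane) : ℂ) + (τ : ℂ) * Complex.I; let dw : ℂ := Complex.I - ((γ⁻¹ • UpperHalfPlane.I : UpperHalfPlane) : ℂ); (fderiv ℝ (u ∘ UpperHalfPlane.ofComplex) w 1 - Complex.I * fderiv ℝ (u ∘ UpperHalfPlane.ofComplex) w Complex.I) / 2 * ((Real.sqrt w.im / ‖w - (t : ℂ)‖ : ℝ) : ℂ) * dw + (u ∘ UpperHalfPlane.ofComplex) w * (((fderiv ℝ (fun x : ℂ => Real.sqrt x.im / ‖x - (t : ℂ)‖) w 1 : ℝ) + Complex.I * (fderiv ℝ (fun x : ℂ => Real.sqrt x.im / ‖x - (t : ℂ)‖) w Complex.I : ℝ)) / 2) * (starRingEnd ℂ) dw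

/-- The route's inlined `lzCocycle` (verbatim): `rpqLZ u γ t` is definitionally `lzCocycle u γ t`. -/
noncomputable def rpqLZ (u : UpperHalfPlane → ℂ) (γ : Matrix.SpecialLinearGroup (Fin 2) ℤ) (t : ℝ) : ℂ :=
  ∫ τ in (0 : ℝ)..1, (let w : ℂ := (1 - (τ : ℂ)) * ((γ⁻¹ • UpperHalfPlane.I : UpperHalfPlane) : ℂ) + (τ : ℂ) * Complex.I; let dw : ℂ := Complex.I - ((γ⁻¹ • UpperHalfPlane.I : UpperHalfPlane) : ℂ); (fderiv ℝ (u ∘ UpperHalfPlane.ofComplex) w 1 - Complex.I * fderiv ℝ (u ∘ UpperHalfPlane.ofComplex) w Complex.I) / 2 * ((Real.sqrt w.im / ‖w - (t : ℂ)‖ : ℝ) : ℂ) * dw + (u ∘ UpperHalfPlane.ofComplex) w * (((fderiv ℝ (fun x : ℂ => Real.sqrt x.im / ‖x - (t : ℂ)‖) w 1 : ℝ) + Complex.I * (fderiv ℝ (fun x : ℂ => Real.sqrt x.im / ‖x - (t : ℂ)‖) w Complex.I : ℝ)) / 2) * (starRingEnd ℂ) dw)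

/-- `rpqLZ` is the interval integral of `rpqLZi`. -/
theorem rpqLZ_eq (u : UpperHalfPlane → ℂ) (γ : Matrix.SpecialLinearGroup (Fin 2) ℤ) (t : ℝ) :
    rpqLZ u γ t = ∫ τ in (0 : ℝ)..1, rpqLZi u γ t τ := rfl

/-- Points of the integration segment from `γ⁻¹ • I` to `I` have positive imaginary part. -/
theorem rpqLZ_seg_im_pos (γ : Matrix.SpecialLinearGroup (Fin 2) ℤ) {τ : ℝ} (h0 : 0 ≤ τ) (h1 : τ ≤ 1) :
    0 < ((1 - (τ : ℂ)) * ((γ⁻¹ • UpperHalfPlane.I : UpperHalfPlane) : ℂ) + (τ : ℂ) * Complex.I).im := by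
  have him : 0 < ((γ⁻¹ • UpperHalfPlane.I : UpperHalfPlane) : ℂ).im := (γ⁻¹ • UpperHalfPlane.I).im_pos
  simp only [Complex.add_im, Complex.mul_im, Complex.sub_re, Complex.one_re, Complex.ofReal_re,
    Complex.sub_im, Complex.one_im, Complex.ofReal_im, sub_zero, Complex.I_re, Complex.I_im, mul_zero,
    zero_mul, add_zero, mul_one]
  rcases lt_or_eq_of_le h1 with h | h
  · nlinarith
  · subst h; nlinarith

/-- The kernel `x ↦ √(Im x)/‖x - t‖` is smooth on the open upper half-plane. -/
theorem rpq_kernel_contDiffOn (t : ℝ) :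
    ContDiffOn ℝ 2 (fun x : ℂ => Real.sqrt x.im / ‖x - (t : ℂ)‖) {z : ℂ | 0 < z.im} := by
  intro x hx
  have hx' : (0 : ℝ) < x.im := hx
  have h1 : ContDiffAt ℝ 2 (fun x : ℂ => Real.sqrt x.im) x := by
    have him : ContDiffAt ℝ 2 (fun x : ℂ => x.im) x := Complex.imCLM.contDiff.contDiffAt
    exact (Real.contDiffAt_sqrt hx'.ne').comp x him
  have h2 : ContDiffAt ℝ 2 (fun x : ℂ => ‖x - (t : ℂ)‖) x := by
    have hne : x - (t : ℂ) ≠ 0 := by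
      intro h
      have := congrArg Complex.im h
      simp at this
      exact hx'.ne' this
    have hsub : ContDiffAt ℝ 2 (fun x : ℂ => x - (t : ℂ)) x := contDiffAt_id.sub contDiffAt_const
    exact (contDiffAt_norm ℝ hne).comp x hsub
  have hne' : ‖x - (t : ℂ)‖ ≠ 0 := by
    rw [norm_ne_zero_iff]
    intro h
    have := congrArg Complex.im h
    simp at this
    exact hx'.ne' this
  exact (h1.div h2 hne').contDiffWithinAt

/-- Continuity of the integrand on `[0,1]` for a `C²` form. -/
theorem rpqLZi_continuousOn (u : UpperHalfPlane → ℂ) (hu : IsC2 u)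
    (γ : Matrix.SpecialLinearGroup (Fin 2) ℤ) (t : ℝ) :
    ContinuousOn (rpqLZi u γ t) (Set.uIcc 0 1) := by
  rw [Set.uIcc_of_le zero_le_one]
  -- the segment
  have hw : Continuous (fun τ : ℝ => ((1 - (τ : ℂ)) * ((γ⁻¹ • UpperHalfPlane.I : UpperHalfPlane) : ℂ) + (τ : ℂ) * Complex.I)) := by fun_prop
  have hmaps : Set.MapsTo (fun τ : ℝ => ((1 - (τ : ℂ)) * ((γ⁻¹ • UpperHalfPlane.I : UpperHalfPlane) : ℂ) + (τ : ℂ) * Complex.I)) (Set.Icc 0 1)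
      {z : ℂ | 0 < z.im} := fun τ hτ => rpqLZ_seg_im_pos γ hτ.1 hτ.2
  -- the form and its derivative along the segment
  have hU : ContinuousOn (u ∘ UpperHalfPlane.ofComplex) {z : ℂ | 0 < z.im} := hu.continuousOn
  have hDU : ContinuousOn (fderiv ℝ (u ∘ UpperHalfPlane.ofComplex)) {z : ℂ | 0 < z.im} :=
    hu.continuousOn_fderiv_of_isOpen (isOpen_lt continuous_const Complex.continuous_im) (by norm_num)
  have hK : ContinuousOn (fun x : ℂ => Real.sqrt x.im / ‖x - (t : ℂ)‖) {z : ℂ | 0 < z.im} :=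
    (rpq_kernel_contDiffOn t).continuousOn
  have hDK : ContinuousOn (fderiv ℝ (fun x : ℂ => Real.sqrt x.im / ‖x - (t : ℂ)‖)) {z : ℂ | 0 < z.im} :=
    (rpq_kernel_contDiffOn t).continuousOn_fderiv_of_isOpen (isOpen_lt continuous_const Complex.continuous_im) (by norm_num)
  have cU : ContinuousOn (fun τ : ℝ => (u ∘ UpperHalfPlane.ofComplex) ((1 - (τ : ℂ)) * ((γ⁻¹ • UpperHalfPlane.I : UpperHalfPlane) : ℂ) + (τ : ℂ) * Complex.I)) (Set.Icc 0 1) := hU.comp hw.continuousOn hmaps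
  have cDU : ContinuousOn (fun τ : ℝ => fderiv ℝ (u ∘ UpperHalfPlane.ofComplex) ((1 - (τ : ℂ)) * ((γ⁻¹ • UpperHalfPlane.I : UpperHalfPlane) : ℂ) + (τ : ℂ) * Complex.I)) (Set.Icc 0 1) :=
    hDU.comp hw.continuousOn hmaps
  have cK : ContinuousOn (fun τ : ℝ => ((Real.sqrt ((1 - (τ : ℂ)) * ((γ⁻¹ • UpperHalfPlane.I : UpperHalfPlane) : ℂ) + (τ : ℂ) * Complex.I).im / ‖((1 - (τ : ℂ)) * ((γ⁻¹ • UpperHalfPlane.I : UpperHalfPlane) : ℂ) + (τ : ℂ) * Complex.I) - (t : ℂ)‖ : ℝ) : ℂ)) (Set.Icc 0 1) :=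
    Complex.continuous_ofReal.comp_continuousOn (hK.comp hw.continuousOn hmaps)
  have cDK : ContinuousOn (fun τ : ℝ => fderiv ℝ (fun x : ℂ => Real.sqrt x.im / ‖x - (t : ℂ)‖) ((1 - (τ : ℂ)) * ((γ⁻¹ • UpperHalfPlane.I : UpperHalfPlane) : ℂ) + (τ : ℂ) * Complex.I)) (Set.Icc 0 1) :=
    hDK.comp hw.continuousOn hmaps
  have cDU1 : ContinuousOn (fun τ : ℝ => fderiv ℝ (u ∘ UpperHalfPlane.ofComplex) ((1 - (τ : ℂ)) * ((γ⁻¹ • UpperHalfPlane.I : UpperHalfPlane) : ℂ) + (τ : ℂ) * Complex.I) 1) (Set.Icc 0 1) :=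
    cDU.clm_apply continuousOn_const
  have cDUI : ContinuousOn (fun τ : ℝ => fderiv ℝ (u ∘ UpperHalfPlane.ofComplex) ((1 - (τ : ℂ)) * ((γ⁻¹ • UpperHalfPlane.I : UpperHalfPlane) : ℂ) + (τ : ℂ) * Complex.I) Complex.I) (Set.Icc 0 1) :=
    cDU.clm_apply continuousOn_const
  have cDK1 : ContinuousOn (fun τ : ℝ => ((fderiv ℝ (fun x : ℂ => Real.sqrt x.im / ‖x - (t : ℂ)‖) ((1 - (τ : ℂ)) * ((γ⁻¹ • UpperHalfPlane.I : UpperHalfPlane) : ℂ) + (τ : ℂ) * Complex.I) 1 : ℝ) : ℂ)) (Set.Icc 0 1) :=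
    Complex.continuous_ofReal.comp_continuousOn (cDK.clm_apply continuousOn_const)
  have cDKI : ContinuousOn (fun τ : ℝ => ((fderiv ℝ (fun x : ℂ => Real.sqrt x.im / ‖x - (t : ℂ)‖) ((1 - (τ : ℂ)) * ((γ⁻¹ • UpperHalfPlane.I : UpperHalfPlane) : ℂ) + (τ : ℂ) * Complex.I) Complex.I : ℝ) : ℂ)) (Set.Icc 0 1) :=
    Complex.continuous_ofReal.comp_continuousOn (cDK.clm_apply continuousOn_const)
  have h : ContinuousOn (fun τ : ℝ => (fderiv ℝ (u ∘ UpperHalfPlane.ofComplex) ((1 - (τ : ℂ)) * ((γ⁻¹ • UpperHalfPlane.I : UpperHalfPlane) : ℂ) + (τ : ℂ) * Complex.I) 1 - Complex.I * fderiv ℝ (u ∘ UpperHalfPlane.ofComplex) ((1 - (τ : ℂ)) * ((γ⁻¹ • UpperHalfPlane.I : UpperHalfPlane) : ℂ) + (τ : ℂ) * Complex.I) Complex.I) / 2 * ((Real.sqrt ((1 - (τ : ℂ)) * ((γ⁻¹ • UpperHalfPlane.I : UpperHalfPlane) : ℂ) + (τ : ℂ) * Complex.I).im / ‖((1 - (τ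 : ℂ)) * ((γ⁻¹ • UpperHalfPlane.I : UpperHalfPlane) : ℂ) + (τ : ℂ) * Complex.I) - (t : ℂ)‖ : ℝ) : ℂ) * (Complex.I - ((γ⁻¹ • UpperHalfPlane.I : UpperHalfPlane) : ℂ)) + (u ∘ UpperHalfPlane.ofComplex) ((1 - (τ : ℂ)) * ((γ⁻¹ • UpperHalfPlane.I : UpperHalfPlane) : ℂ) + (τ : ℂ) * Complex.I) * (((fderiv ℝ (fun x : ℂ => Real.sqrt x.im / ‖x - (t : ℂ)‖) ((1 - (τ : ℂ)) * ((γ⁻¹ • UpperHalfPlane.I : UpperHalfPlane) : ℂ) + (τ : ℂ) * Complex.I) 1 : ℝ) + Complex.I * (fderiv ℝ (fun x : ℂ => Real.sqrt x.im / ‖x - (t : ℂ)‖) ((1 - (τ : ℂ)) * ((γ⁻¹ • UpperHalfPlane.I : UpperHalfPlane) : ℂ) + (τ : ℂ) * Complex.I) Complex.I : ℝ)) / 2) * (starRingEnd ℂ) (Complex.I - ((γ⁻¹ • UpperHalfPlane.I : UpperHalfPlane) : ℂ))) (Set.Icc 0 1) :=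
    ((((cDU1.sub (continuousOn_const.mul cDUI)).div_const 2).mul cK).mul continuousOn_const).add
      ((cU.mul ((cDK1.add (continuousOn_const.mul cDKI)).div_const 2)).mul continuousOn_const)
  exact h.congr fun τ _ => by simp only [rpqLZi]

/-- Interval integrability of the integrand for a `C²` form. -/
theorem rpqLZi_intervalIntegrable (u : UpperHalfPlane → ℂ) (hu : IsC2 u)
    (γ : Matrix.SpecialLinearGroup (Fin 2) ℤ) (t : ℝ) :
    IntervalIntegrable (rpqLZi u γ t) MeasureTheory.volume 0 1 :=
  (rpqLZi_continuousOn u hu γ t).intervalIntegrable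

/-- Differentiability of a `C²` form at the points of the segment. -/
theorem rpq_differentiableAt_seg (u : UpperHalfPlane → ℂ) (hu : IsC2 u)
    (γ : Matrix.SpecialLinearGroup (Fin 2) ℤ) {τ : ℝ} (h0 : 0 ≤ τ) (h1 : τ ≤ 1) :
    DifferentiableAt ℝ (u ∘ UpperHalfPlane.ofComplex)
      ((1 - (τ : ℂ)) * ((γ⁻¹ • UpperHalfPlane.I : UpperHalfPlane) : ℂ) + (τ : ℂ) * Complex.I) :=
  (hu.differentiableOn (by norm_num)).differentiableAt
    ((isOpen_lt continuous_const Complex.continuous_im).mem_nhds (rpqLZ_seg_im_pos γ h0 h1))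

/-- Additivity of the integrand on `[0,1]`. -/
theorem rpqLZi_add (u v : UpperHalfPlane → ℂ) (hu : IsC2 u) (hv : IsC2 v)
    (γ : Matrix.SpecialLinearGroup (Fin 2) ℤ) (t : ℝ) {τ : ℝ} (hτ : τ ∈ Set.uIcc (0 : ℝ) 1) :
    rpqLZi (u + v) γ t τ = rpqLZi u γ t τ + rpqLZi v γ t τ := by
  rw [Set.uIcc_of_le zero_le_one] at hτ
  have hcomp : (u + v) ∘ UpperHalfPlane.ofComplex =
      (u ∘ UpperHalfPlane.ofComplex) + (v ∘ UpperHalfPlane.ofComplex) := rfl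
  simp only [rpqLZi, hcomp, fderiv_add (rpq_differentiableAt_seg u hu γ hτ.1 hτ.2)
    (rpq_differentiableAt_seg v hv γ hτ.1 hτ.2), add_apply, Pi.add_apply,
    Function.comp]
  ring

/-- Homogeneity of the integrand on `[0,1]`. -/
theorem rpqLZi_smul (c : ℂ) (u : UpperHalfPlane → ℂ) (hu : IsC2 u)
    (γ : Matrix.SpecialLinearGroup (Fin 2) ℤ) (t : ℝ) {τ : ℝ} (hτ : τ ∈ Set.uIcc (0 : ℝ) 1) :
    rpqLZi (c • u) γ t τ = c * rpqLZi u γ t τ := by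
  rw [Set.uIcc_of_le zero_le_one] at hτ
  have hcomp : (c • u) ∘ UpperHalfPlane.ofComplex = c • (u ∘ UpperHalfPlane.ofComplex) := rfl
  simp only [rpqLZi, hcomp, fderiv_const_smul (rpq_differentiableAt_seg u hu γ hτ.1 hτ.2) c,
    smul_apply, Pi.smul_apply, smul_eq_mul, Function.comp]
  ring

/-- The integrand of the zero form vanishes. -/
theorem rpqLZi_zero (γ : Matrix.SpecialLinearGroup (Fin 2) ℤ) (t τ : ℝ) :
    rpqLZi 0 γ t τ = 0 := by
  have hcomp : (0 : UpperHalfPlane → ℂ) ∘ UpperHalfPlane.ofComplex = 0 := rfl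
  simp only [rpqLZi, hcomp, fderiv_zero, Pi.zero_apply, zero_apply]
  ring

/-- `C²` forms are stable under addition. -/
theorem isC2_add' (u v : UpperHalfPlane → ℂ) (hu : IsC2 u) (hv : IsC2 v) : IsC2 (u + v) := by
  have hcomp : (u + v) ∘ UpperHalfPlane.ofComplex =
      (u ∘ UpperHalfPlane.ofComplex) + (v ∘ UpperHalfPlane.ofComplex) := rfl
  unfold IsC2
  rw [hcomp]
  exact hu.add hv

/-- `C²` forms are stable under scalars. -/
theorem isC2_smul' (c : ℂ) (u : UpperHalfPlane → ℂ) (hu : IsC2 u) : IsC2 (c • u) := by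
  have hcomp : (c • u) ∘ UpperHalfPlane.ofComplex = c • (u ∘ UpperHalfPlane.ofComplex) := rfl
  unfold IsC2
  rw [hcomp]
  exact hu.const_smul c

/-- The zero form is `C²`. -/
theorem isC2_zero' : IsC2 (0 : UpperHalfPlane → ℂ) := isC2_const 0

/-- LINEARITY (additive part): `lzCocycle (u + v) = lzCocycle u + lzCocycle v` for `C²` forms. -/
theorem rpqLZ_add (u v : UpperHalfPlane → ℂ) (hu : IsC2 u) (hv : IsC2 v)
    (γ : Matrix.SpecialLinearGroup (Fin 2) ℤ) (t : ℝ) :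
    rpqLZ (u + v) γ t = rpqLZ u γ t + rpqLZ v γ t := by
  rw [rpqLZ_eq, rpqLZ_eq, rpqLZ_eq, ← intervalIntegral.integral_add (rpqLZi_intervalIntegrable u hu γ t)
    (rpqLZi_intervalIntegrable v hv γ t)]
  exact intervalIntegral.integral_congr fun τ hτ => rpqLZi_add u v hu hv γ t hτ

/-- LINEARITY (homogeneous part): `lzCocycle (c • u) = c * lzCocycle u` for a `C²` form. -/
theorem rpqLZ_smul (c : ℂ) (u : UpperHalfPlane → ℂ) (hu : IsC2 u)
    (γ : Matrix.SpecialLinearGroup (Fin 2) ℤ) (t : ℝ) :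
    rpqLZ (c • u) γ t = c * rpqLZ u γ t := by
  rw [rpqLZ_eq, rpqLZ_eq, ← intervalIntegral.integral_const_mul]
  exact intervalIntegral.integral_congr fun τ hτ => rpqLZi_smul c u hu γ t hτ

/-- `lzCocycle 0 = 0`. -/
theorem rpqLZ_zero (γ : Matrix.SpecialLinearGroup (Fin 2) ℤ) (t : ℝ) : rpqLZ 0 γ t = 0 := by
  rw [rpqLZ_eq]
  simp [rpqLZi_zero]

/-- `C²` forms are stable under finite linear combinations. -/
theorem isC2_linComb {ι : Type*} (s : Finset ι) (c : ι → ℂ) (v : ι → UpperHalfPlane → ℂ)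
    (hv : ∀ j ∈ s, IsC2 (v j)) : IsC2 (∑ j ∈ s, c j • v j) := by
  classical
  induction s using Finset.induction_on with
  | empty => simpa using isC2_zero'
  | insert a s ha ih =>
    rw [Finset.sum_insert ha]
    exact isC2_add' _ _ (isC2_smul' _ _ (hv a (Finset.mem_insert_self a s)))
      (ih fun j hj => hv j (Finset.mem_insert_of_mem hj))

/-- LINEARITY: `lzCocycle (∑ cⱼ • vⱼ) γ t = ∑ cⱼ * lzCocycle vⱼ γ t` for `C²` forms `vⱼ`. -/
theorem rpqLZ_linComb {ι : Type*} (s : Finset ι) (c : ι → ℂ) (v : ι → UpperHalfPlane → ℂ)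
    (hv : ∀ j ∈ s, IsC2 (v j)) (γ : Matrix.SpecialLinearGroup (Fin 2) ℤ) (t : ℝ) :
    rpqLZ (∑ j ∈ s, c j • v j) γ t = ∑ j ∈ s, c j * rpqLZ (v j) γ t := by
  classical
  induction s using Finset.induction_on with
  | empty => simpa using rpqLZ_zero γ t
  | insert a s ha ih =>
    rw [Finset.sum_insert ha, Finset.sum_insert ha,
      rpqLZ_add _ _ (isC2_smul' _ _ (hv a (Finset.mem_insert_self a s)))
        (isC2_linComb s c v fun j hj => hv j (Finset.mem_insert_of_mem hj)),
      rpqLZ_smul _ _ (hv a (Finset.mem_insert_self a s)),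
      ih fun j hj => hv j (Finset.mem_insert_of_mem hj)]

end Summit.Langlands.Langlands.Theorems
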